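import Literature.Analysis.FluidPDE.NewtonGradientPotential
import Literature.Analysis.FluidPDE.LagrangianTimeDerivativeTools
import Literature.Analysis.FluidPDE.BiotSavartGradient
import Literature.Analysis.FluidPDE.BiotSavartCurlPair
import HarnessLib

/-!
# The curl of the Biot–Savart velocity of a Hölder density: `curl (K₃ ∗ h) = h − ∇ div (Γ ∗ h)`
# (the Hodge/Leray decomposition of a `C^γ_c` field, Majda–Bertozzi Prop. 2.16 without `div h = 0`)

Analysis/FluidPDE support file (everything proved; no definitions, no named facts) on the
discharge path of the named fact
`Literature.Analysis.FluidPDE.MajdaBertozzi2002_particleTrajectoryEuler`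
(`HolderEulerLagrangian.lean`; A. J. Majda, A. L. Bertozzi, *Vorticity and Incompressible Flow*,
CUP 2002, §2.5 **Prop. 2.23**, p. 72–73 of the held text). The previous file of the path shows
`∂ₜv = curl (K₃ ∗ h)` with `h = v × ω ∈ C^γ_c`; to read this as the Euler equation with a
pressure one needs the curl of the Biot–Savart velocity of a density which is **not**
divergence free (the tree's `curl_biotSavart_eq_of_holderWith`, Prop. 2.16, covers only
`div h = 0`). For `h : ℝ³ → ℝ³` compactly supported and `γ`-Hölder, `0 < γ < 1`:

* `exists_isC1SingularKernel_fderiv_newtonKernel` — `DΓ` is a `C¹` singular kernel of degree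
  `−2` (`‖DΓ(z)‖ = (4π|z|²)⁻¹`, `D²Γ` homogeneous of degree `−3`);
* `biotSavart_eq_neg_toLp` — **`K₃ ∗ h = −"curl" of the first-derivative potentials**
  `T_a h = ∂_a(Γ ∗ h)` (`newtonGradPotential`, `NewtonGradientPotential.lean`):
  `(K₃ ∗ h)₀ = −((T₁h)₂ − (T₂h)₁)` etc. (`K(z)w = −curlCLM(DΓ(z) ⊗ w)`, the tree's
  `biotSavartKernel_eq_neg_curlCLM_smulRight`, (2.92)–(2.94));
* `divNewtonPotential` is not a definition but the function `x ↦ ∫ DΓ(x − y)(h(y)) dy =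
  Σⱼ (T_{eⱼ} h)ⱼ = div (Γ ∗ h)` (`integral_fderiv_newtonKernel_apply_eq_sum`); it is `C¹` with
  `∂ᵢ ∫ DΓ(· − y) h = Σⱼ (∂ᵢ T_{eⱼ} h)ⱼ` (`fderiv_integral_fderiv_newtonKernel_apply`);
* `curl_biotSavart_eq_sub_gradient` — **`curl (K₃ ∗ h) = h − ∇ ∫ DΓ(· − y)(h y) dy`**: expand
  both sides in the six numbers `(∂ₘ T_{eⱼ} h)ₖ` and use the symmetry `∂_b T_a = ∂_a T_b` and
  the trace identity `Σᵢ ∂ᵢ T_{eᵢ} h = h` (`Δ(Γ ∗ h) = h`) of `NewtonGradientPotential.lean` —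
  this is `curl curl = ∇ div − Δ` applied to the vector potential `−Γ ∗ h`, at the `C^{γ}`
  level where only the first-derivative potentials are classical.

## Mathlib / tree search

`lean search 'curl_biotSavart'`: the divergence-free cases `curl_biotSavart_eq_of_isWeaklyDivFree`,
`curl_biotSavart_eq_of_holderWith` (`BiotSavartHolderCurl.lean`), `curl_biotSavart_holds`
(`BiotSavartDivCurl.lean`); no general density. Used: `newtonGradPotential`,
`hasFDerivAt_newtonGradPotential`, `contDiff_one_newtonGradPotential`,
`fderiv_newtonGradPotential_comm`, `sum_fderiv_newtonGradPotential_apply_self`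
(`NewtonGradientPotential.lean`), `biotSavartKernel_eq_neg_curlCLM_smulRight`,
`integrable_fderiv_newtonKernel_smulRight`, `integrable_fderiv_newtonKernel_smul`,
`norm_fderiv_newtonKernel_le` (`BiotSavartNewtonKernel.lean`), `fderiv2_newtonKernel_homogeneous`,
`contDiffOn_fderiv_newtonKernel` (`NewtonKernel.lean`), `contDiff_biotSavart`,
`IsC1SingularKernel` (`BiotSavartGradient.lean`, `SingularKernelTruncation.lean`), `curlCLM_apply`,
`inner_gradient_left` (`BiotSavartCurlPair.lean`), `integral_apply_fin_three`,
`clm_apply_eq_sum_coord` (`LagrangianTimeDerivativeTools.lean`).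

## References

* A. J. Majda, A. L. Bertozzi, *Vorticity and Incompressible Flow* (CUP 2002), §2.4.1
  Prop. 2.16 with (2.92)–(2.96) (p. 63–64 of the held text), §1.8 (Hodge decomposition). [MajdaBertozziCUP2002]
* D. Gilbarg, N. S. Trudinger, *Elliptic Partial Differential Equations of Second Order*
  (2001), Lemmas 4.1–4.2, 4.4. [GilbargTrudinger2001]
-/

noncomputable section

open MeasureTheory Set Function Filter Metric InnerProductSpace
open _root_.Topology
open scoped NNReal RealInnerProductSpace

namespace Literature.Analysis.FluidPDE

/-! ### `DΓ` is a `C¹` singular kernel of degree `−2` -/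

set_option maxSynthPendingDepth 3 in
/-- **`DΓ` is a `C¹` singular kernel**: `C¹` off the origin, `‖DΓ(z)‖ ≤ A|z|⁻²`,
`‖D²Γ(z)‖ ≤ A|z|⁻³` (`D²Γ` is homogeneous of degree `−3` and bounded on the unit sphere).
This is the kernel of the divergence-type potential `∫ DΓ(x − y)(h y) dy = div (Γ ∗ h)(x)`
(the pressure `div Γ ∗ (v × ω)`). [cite: GilbargTrudinger2001, Lemma 4.1 with (4.9)] -/
theorem exists_isC1SingularKernel_fderiv_newtonKernel :
    ∃ A : ℝ, IsC1SingularKernel (fun z : EuclideanSpace ℝ (Fin 3) => fderiv ℝ newtonKernel z) A := by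
  have hD : ∀ c : ℝ, 0 < c → ∀ z : EuclideanSpace ℝ (Fin 3),
      fderiv ℝ (fderiv ℝ newtonKernel) (c • z) = c ^ (-3 : ℤ) • fderiv ℝ (fderiv ℝ newtonKernel) z :=
    fderiv2_newtonKernel_homogeneous
  have hcont : ContinuousOn (fderiv ℝ (fderiv ℝ newtonKernel)) (sphere (0 : EuclideanSpace ℝ (Fin 3)) 1) := by
    intro u hu
    have hu0 : u ≠ 0 := by
      intro h
      rw [h, mem_sphere_zero_iff_norm, norm_zero] at hu
      exact zero_ne_one hu
    exact ((contDiffOn_fderiv_newtonKernel (n := 1)).contDiffAt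
      (isOpen_compl_singleton.mem_nhds hu0)).continuousAt_fderiv one_ne_zero |>.continuousWithinAt
  obtain ⟨M, hM⟩ := (isCompact_sphere (0 : EuclideanSpace ℝ (Fin 3)) 1).exists_bound_of_continuousOn
    (f := fderiv ℝ (fderiv ℝ newtonKernel)) hcont
  refine ⟨max (4 * Real.pi)⁻¹ (max M 0), ?_, fun z => ?_, fun z hz => ?_⟩
  · intro z hz
    exact (contDiffOn_fderiv_newtonKernel (n := 1)).contDiffAt (isOpen_compl_singleton.mem_nhds hz)
  · calc ‖fderiv ℝ newtonKernel z‖ ≤ (4 * Real.pi * ‖z‖ ^ 2)⁻¹ := norm_fderiv_newtonKernel_le z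
      _ = (4 * Real.pi)⁻¹ * (‖z‖ ^ 2)⁻¹ := by rw [mul_inv]
      _ ≤ max (4 * Real.pi)⁻¹ (max M 0) * (‖z‖ ^ 2)⁻¹ :=
          mul_le_mul_of_nonneg_right (le_max_left _ _) (by positivity)
  · have hzn : 0 < ‖z‖ := norm_pos_iff.2 hz
    set u : EuclideanSpace ℝ (Fin 3) := ‖z‖⁻¹ • z with hu
    have hun : ‖u‖ = 1 := by
      rw [hu, norm_smul, norm_inv, norm_norm, inv_mul_cancel₀ hzn.ne']
    have hzu : z = ‖z‖ • u := by
      rw [hu, smul_smul, mul_inv_cancel₀ hzn.ne', one_smul]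
    have h1 : fderiv ℝ (fderiv ℝ newtonKernel) z = ‖z‖ ^ (-3 : ℤ) • fderiv ℝ (fderiv ℝ newtonKernel) u := by
      conv_lhs => rw [hzu]
      exact hD ‖z‖ hzn u
    have hMu : ‖fderiv ℝ (fderiv ℝ newtonKernel) u‖ ≤ M := hM u (mem_sphere_zero_iff_norm.2 hun)
    have hM0 : M ≤ max (4 * Real.pi)⁻¹ (max M 0) := (le_max_left _ _).trans (le_max_right _ _)
    have hzpow : ‖z‖ ^ (-3 : ℤ) = (‖z‖ ^ 3)⁻¹ := by
      rw [show (-3 : ℤ) = -((3 : ℕ) : ℤ) by norm_num, zpow_neg, zpow_natCast]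
    show ‖fderiv ℝ (fun z => fderiv ℝ newtonKernel z) z‖ ≤ _
    rw [show (fun z : EuclideanSpace ℝ (Fin 3) => fderiv ℝ newtonKernel z) = fderiv ℝ newtonKernel from rfl,
      h1, hzpow, norm_smul, Real.norm_eq_abs, abs_of_nonneg (by positivity)]
    calc (‖z‖ ^ 3)⁻¹ * ‖fderiv ℝ (fderiv ℝ newtonKernel) u‖ ≤ (‖z‖ ^ 3)⁻¹ * max (4 * Real.pi)⁻¹ (max M 0) :=
          mul_le_mul_of_nonneg_left (hMu.trans hM0) (by positivity)
      _ = max (4 * Real.pi)⁻¹ (max M 0) * (‖z‖ ^ 3)⁻¹ := by ring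

/-! ### The Biot–Savart velocity through the first-derivative potentials -/

section Representation

variable {h : EuclideanSpace ℝ (Fin 3) → EuclideanSpace ℝ (Fin 3)} (hc : Continuous h) (hs : HasCompactSupport h)
include hc hs

/-- **`K₃ ∗ h = −curlCLM ∫ DΓ(x − y) ⊗ h(y) dy`** for a continuous compactly supported density
(off the null diagonal the kernel is `−curlCLM (DΓ ⊗ ·)`, and `curlCLM` passes through the
Bochner integral; Majda–Bertozzi (2.92)–(2.94): `v = −curl ψ`, `ψ = Γ ∗ h`). [cite: MajdaBertozziCUP2002, §2.4.1 Prop. 2.16 with (2.92)–(2.94) (p. 63–64)] -/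
theorem biotSavart_eq_neg_curlCLM_integral (x : EuclideanSpace ℝ (Fin 3)) :
    biotSavart h x = -curlCLM (∫ y, (fderiv ℝ newtonKernel (x - y)).smulRight (h y)) := by
  have hT := integrable_fderiv_newtonKernel_smulRight hc hs x
  rw [biotSavart]
  have hae : (fun y => biotSavartKernel (x - y) (h y)) =ᵐ[volume]
      fun y => -curlCLM ((fderiv ℝ newtonKernel (x - y)).smulRight (h y)) := by
    filter_upwards [Measure.ae_ne volume x] with y hy
    exact biotSavartKernel_eq_neg_curlCLM_smulRight (sub_ne_zero.2 (Ne.symm hy)) (h y)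
  rw [integral_congr_ae hae, integral_neg, ContinuousLinearMap.integral_comp_comm curlCLM hT]

/-- The operator `∫ DΓ(x − y) ⊗ h(y) dy` evaluated at `a` is the first-derivative potential
`T_a h (x) = ∫ ∂_aΓ(x − y) h(y) dy`. [cite: GilbargTrudinger2001, Lemma 4.1 with (4.9)] -/
theorem integral_smulRight_apply (x a : EuclideanSpace ℝ (Fin 3)) :
    (∫ y, (fderiv ℝ newtonKernel (x - y)).smulRight (h y)) a = newtonGradPotential a h x := by
  rw [ContinuousLinearMap.integral_apply (integrable_fderiv_newtonKernel_smulRight hc hs x) a]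
  rfl

/-- **Components of the Biot–Savart velocity through the gradient potentials**:
`K₃ ∗ h (x) = −( (T₁h)₂ − (T₂h)₁, (T₂h)₀ − (T₀h)₂, (T₀h)₁ − (T₁h)₀ )(x)`, `Tⱼ = T_{eⱼ}`. [cite: MajdaBertozziCUP2002, §2.4.1 (2.92)–(2.94) (p. 63–64)] -/
theorem biotSavart_eq_neg_toLp (x : EuclideanSpace ℝ (Fin 3)) :
    biotSavart h x = -(WithLp.toLp 2
      ![newtonGradPotential (EuclideanSpace.single 1 (1 : ℝ)) h x 2 - newtonGradPotential (EuclideanSpace.single 2 (1 : ℝ)) h x 1,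
        newtonGradPotential (EuclideanSpace.single 2 (1 : ℝ)) h x 0 - newtonGradPotential (EuclideanSpace.single 0 (1 : ℝ)) h x 2,
        newtonGradPotential (EuclideanSpace.single 0 (1 : ℝ)) h x 1 - newtonGradPotential (EuclideanSpace.single 1 (1 : ℝ)) h x 0]) := by
  rw [biotSavart_eq_neg_curlCLM_integral hc hs x, curlCLM_apply]
  simp only [integral_smulRight_apply hc hs]

/-- Components: `(K₃ ∗ h)ᵢ(x)` in terms of the `(Tⱼ h)ₖ(x)`. [cite: MajdaBertozziCUP2002, §2.4.1 (2.92)–(2.94) (p. 63–64)] -/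
theorem biotSavart_apply (x : EuclideanSpace ℝ (Fin 3)) (i : Fin 3) :
    biotSavart h x i = -(![newtonGradPotential (EuclideanSpace.single 1 (1 : ℝ)) h x 2 - newtonGradPotential (EuclideanSpace.single 2 (1 : ℝ)) h x 1,
        newtonGradPotential (EuclideanSpace.single 2 (1 : ℝ)) h x 0 - newtonGradPotential (EuclideanSpace.single 0 (1 : ℝ)) h x 2,
        newtonGradPotential (EuclideanSpace.single 0 (1 : ℝ)) h x 1 - newtonGradPotential (EuclideanSpace.single 1 (1 : ℝ)) h x 0] i) := by
  rw [biotSavart_eq_neg_toLp hc hs x, PiLp.neg_apply, PiLp.toLp_apply]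

/-- **`∫ DΓ(x − y)(h(y)) dy = Σⱼ (T_{eⱼ} h)ⱼ(x)`**: the divergence-type potential is the trace of
the gradient potentials (linearity of `DΓ(x − y)` in the direction). [cite: GilbargTrudinger2001, Lemma 4.1 with (4.9)] -/
theorem integral_fderiv_newtonKernel_apply_eq_sum (x : EuclideanSpace ℝ (Fin 3)) :
    ∫ y, fderiv ℝ newtonKernel (x - y) (h y) =
      ∑ j : Fin 3, newtonGradPotential (EuclideanSpace.single j (1 : ℝ)) h x j := by
  have hint : ∀ j : Fin 3, Integrable fun y => fderiv ℝ newtonKernel (x - y) (EuclideanSpace.single j (1 : ℝ)) • h y :=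
    fun j => integrable_fderiv_newtonKernel_smul hc hs x _
  have e : ∀ y, fderiv ℝ newtonKernel (x - y) (h y) =
      ∑ j : Fin 3, (fderiv ℝ newtonKernel (x - y) (EuclideanSpace.single j (1 : ℝ)) • h y) j := by
    intro y
    have hv : h y = ∑ j : Fin 3, h y j • EuclideanSpace.single j (1 : ℝ) := by
      simpa using ((EuclideanSpace.basisFun (Fin 3) ℝ).sum_repr (h y)).symm
    conv_lhs => rw [hv]
    simp only [map_sum, map_smul, smul_eq_mul, PiLp.smul_apply]
    refine Finset.sum_congr rfl fun j _ => ?_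
    ring
  simp_rw [e]
  rw [integral_finsetSum _ fun j _ => ?_]
  · refine Finset.sum_congr rfl fun j _ => ?_
    rw [← integral_apply_fin_three (hint j) j]
    rfl
  · have h2 := (hint j)
    exact (EuclideanSpace.proj (𝕜 := ℝ) j).integrable_comp h2

end Representation

/-! ### Derivatives: components, the divergence potential, symmetry and trace -/

/-- Components commute with the Fréchet derivative: `∂ᵥ(fᵢ) = (∂ᵥf)ᵢ`. [folklore] -/
theorem fderiv_apply_comp {E' : Type*} [NormedAddCommGroup E'] [NormedSpace ℝ E']
    {f : E' → EuclideanSpace ℝ (Fin 3)} {x : E'} (hf : DifferentiableAt ℝ f x) (i : Fin 3) (v : E') :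
    fderiv ℝ (fun y => f y i) x v = fderiv ℝ f x v i := by
  have h := ((EuclideanSpace.proj (𝕜 := ℝ) i).hasFDerivAt.comp x hf.hasFDerivAt).fderiv
  rw [show (fun y => f y i) = (EuclideanSpace.proj (𝕜 := ℝ) i) ∘ f from rfl, h]
  rfl

/-- Differentiability of components. [folklore] -/
theorem differentiableAt_apply_comp {E' : Type*} [NormedAddCommGroup E'] [NormedSpace ℝ E']
    {f : E' → EuclideanSpace ℝ (Fin 3)} {x : E'} (hf : DifferentiableAt ℝ f x) (i : Fin 3) :
    DifferentiableAt ℝ (fun y => f y i) x :=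
  ((EuclideanSpace.proj (𝕜 := ℝ) i).hasFDerivAt.comp x hf.hasFDerivAt).differentiableAt

section Holder

variable {h : EuclideanSpace ℝ (Fin 3) → EuclideanSpace ℝ (Fin 3)} {Ch γ : ℝ≥0}
  (hH : HolderWith Ch γ h) (hγ : 0 < γ) (hγ1 : γ < 1) (hs : HasCompactSupport h)
include hH hγ hγ1 hs

/-- The gradient potentials of a compactly supported Hölder density are differentiable. [cite: GilbargTrudinger2001, Lemma 4.2] -/
theorem differentiable_newtonGradPotential (a : EuclideanSpace ℝ (Fin 3)) :
    Differentiable ℝ (newtonGradPotential a h) :=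
  (contDiff_one_newtonGradPotential a hH hγ hγ1 hs).differentiable one_ne_zero

/-- **The divergence potential `∫ DΓ(· − y)(h y) dy` is `C¹`.** [cite: GilbargTrudinger2001, Lemma 4.2] -/
theorem contDiff_integral_fderiv_newtonKernel_apply :
    ContDiff ℝ 1 fun x => ∫ y, fderiv ℝ newtonKernel (x - y) (h y) := by
  have e : (fun x => ∫ y, fderiv ℝ newtonKernel (x - y) (h y)) =
      fun x => ∑ j : Fin 3, newtonGradPotential (EuclideanSpace.single j (1 : ℝ)) h x j :=
    funext fun x => integral_fderiv_newtonKernel_apply_eq_sum (hH.continuous hγ) hs x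
  rw [e]
  refine ContDiff.sum fun j _ => ?_
  exact (EuclideanSpace.proj (𝕜 := ℝ) j).contDiff.comp (contDiff_one_newtonGradPotential _ hH hγ hγ1 hs)

/-- **`∂ᵥ ∫ DΓ(· − y)(h y) dy = Σⱼ (∂ᵥ T_{eⱼ} h)ⱼ`.** [cite: GilbargTrudinger2001, Lemma 4.2 with (4.10)] -/
theorem fderiv_integral_fderiv_newtonKernel_apply (x v : EuclideanSpace ℝ (Fin 3)) :
    fderiv ℝ (fun x => ∫ y, fderiv ℝ newtonKernel (x - y) (h y)) x v =
      ∑ j : Fin 3, fderiv ℝ (newtonGradPotential (EuclideanSpace.single j (1 : ℝ)) h) x v j := by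
  have e : (fun x => ∫ y, fderiv ℝ newtonKernel (x - y) (h y)) =
      fun x => ∑ j : Fin 3, newtonGradPotential (EuclideanSpace.single j (1 : ℝ)) h x j :=
    funext fun x => integral_fderiv_newtonKernel_apply_eq_sum (hH.continuous hγ) hs x
  rw [e, fderiv_fun_sum fun j _ => differentiableAt_apply_comp (differentiable_newtonGradPotential hH hγ hγ1 hs _ x) j,
    sum_apply]
  refine Finset.sum_congr rfl fun j _ => ?_
  exact fderiv_apply_comp (differentiable_newtonGradPotential hH hγ hγ1 hs _ x) j v

/-- **The gradient of the divergence potential, componentwise**: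
`(∇ ∫ DΓ(· − y)(h y) dy)ᵢ = Σⱼ (∂ᵢ T_{eⱼ} h)ⱼ`. [cite: GilbargTrudinger2001, Lemma 4.2 with (4.10)] -/
theorem gradient_integral_fderiv_newtonKernel_apply (x : EuclideanSpace ℝ (Fin 3)) (i : Fin 3) :
    gradient (fun x => ∫ y, fderiv ℝ newtonKernel (x - y) (h y)) x i =
      ∑ j : Fin 3, fderiv ℝ (newtonGradPotential (EuclideanSpace.single j (1 : ℝ)) h) x
        (EuclideanSpace.single i (1 : ℝ)) j := by
  rw [← fderiv_integral_fderiv_newtonKernel_apply hH hγ hγ1 hs x, ← inner_gradient_left,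
    EuclideanSpace.inner_single_right]
  simp

/-- **Symmetry of the second derivatives, componentwise**: `(∂ₖ T_{eⱼ} h)ᵢ = (∂ⱼ T_{eₖ} h)ᵢ`. [cite: GilbargTrudinger2001, Lemma 4.2] -/
theorem fderiv_newtonGradPotential_single_comm (x : EuclideanSpace ℝ (Fin 3)) (j k i : Fin 3) :
    fderiv ℝ (newtonGradPotential (EuclideanSpace.single j (1 : ℝ)) h) x (EuclideanSpace.single k (1 : ℝ)) i =
      fderiv ℝ (newtonGradPotential (EuclideanSpace.single k (1 : ℝ)) h) x (EuclideanSpace.single j (1 : ℝ)) i := by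
  rw [fderiv_newtonGradPotential_comm _ _ hH hγ hγ1 hs x]

/-- **The trace identity, componentwise**: `Σⱼ (∂ⱼ T_{eⱼ} h)ᵢ = hᵢ` (`Δ(Γ ∗ h) = h`). [cite: GilbargTrudinger2001, Lemma 4.2] -/
theorem sum_fderiv_newtonGradPotential_single_apply (x : EuclideanSpace ℝ (Fin 3)) (i : Fin 3) :
    ∑ j : Fin 3, fderiv ℝ (newtonGradPotential (EuclideanSpace.single j (1 : ℝ)) h) x
        (EuclideanSpace.single j (1 : ℝ)) i = h x i := by
  have hv := sum_fderiv_newtonGradPotential_apply_self hH hγ hγ1 hs x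
  have hcomp := congrArg (fun w : EuclideanSpace ℝ (Fin 3) => (EuclideanSpace.proj (𝕜 := ℝ) i) w) hv
  simp only [map_sum] at hcomp
  exact hcomp

/-- **The derivative of the Biot–Savart velocity through the gradient potentials**:
`(∂ᵥ K₃ ∗ h)ᵢ` is minus the corresponding combination of the `(∂ᵥ Tⱼ h)ₖ`. [cite: MajdaBertozziCUP2002, §2.4.1 (2.92)–(2.94) (p. 63–64)] -/
theorem fderiv_biotSavart_apply (x v : EuclideanSpace ℝ (Fin 3)) (i : Fin 3) :
    fderiv ℝ (biotSavart h) x v i =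
      -(![fderiv ℝ (newtonGradPotential (EuclideanSpace.single 1 (1 : ℝ)) h) x v 2 -
            fderiv ℝ (newtonGradPotential (EuclideanSpace.single 2 (1 : ℝ)) h) x v 1,
          fderiv ℝ (newtonGradPotential (EuclideanSpace.single 2 (1 : ℝ)) h) x v 0 -
            fderiv ℝ (newtonGradPotential (EuclideanSpace.single 0 (1 : ℝ)) h) x v 2,
          fderiv ℝ (newtonGradPotential (EuclideanSpace.single 0 (1 : ℝ)) h) x v 1 -
            fderiv ℝ (newtonGradPotential (EuclideanSpace.single 1 (1 : ℝ)) h) x v 0] i) := by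
  have hK : DifferentiableAt ℝ (biotSavart h) x := (contDiff_biotSavart hγ hH hs).differentiable one_ne_zero x
  have hD := fun a => differentiable_newtonGradPotential hH hγ hγ1 hs a x
  have hDc := fun a k => differentiableAt_apply_comp (hD a) k
  rw [← fderiv_apply_comp hK i v]
  have e : (fun y => biotSavart h y i) = fun y =>
      -(![newtonGradPotential (EuclideanSpace.single 1 (1 : ℝ)) h y 2 - newtonGradPotential (EuclideanSpace.single 2 (1 : ℝ)) h y 1,
          newtonGradPotential (EuclideanSpace.single 2 (1 : ℝ)) h y 0 - newtonGradPotential (EuclideanSpace.single 0 (1 : ℝ)) h y 2,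
          newtonGradPotential (EuclideanSpace.single 0 (1 : ℝ)) h y 1 - newtonGradPotential (EuclideanSpace.single 1 (1 : ℝ)) h y 0] i) :=
    funext fun y => biotSavart_apply (hH.continuous hγ) hs y i
  rw [e]
  fin_cases i
  · simp only [Fin.zero_eta, Fin.isValue, Matrix.cons_val_zero]
    rw [fderiv_fun_neg, neg_apply, fderiv_fun_sub (hDc _ 2) (hDc _ 1),
      sub_apply, fderiv_apply_comp (hD _) 2 v, fderiv_apply_comp (hD _) 1 v]
  · simp only [Fin.mk_one, Fin.isValue, Matrix.cons_val_one, Matrix.cons_val_zero]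
    rw [fderiv_fun_neg, neg_apply, fderiv_fun_sub (hDc _ 0) (hDc _ 2),
      sub_apply, fderiv_apply_comp (hD _) 0 v, fderiv_apply_comp (hD _) 2 v]
  · simp only [Fin.reduceFinMk, Fin.isValue, Matrix.cons_val]
    rw [fderiv_fun_neg, neg_apply, fderiv_fun_sub (hDc _ 1) (hDc _ 0),
      sub_apply, fderiv_apply_comp (hD _) 1 v, fderiv_apply_comp (hD _) 0 v]

/-- **`curl (K₃ ∗ h) = h − ∇ div (Γ ∗ h)` for a compactly supported `γ`-Hölder density**
(`0 < γ < 1`): with `q(x) = ∫ DΓ(x − y)(h(y)) dy` (`= div (Γ ∗ h)(x)`),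
`curl (biotSavart h) x = h x − ∇q(x)`. Proof: both sides are polynomial in the six numbers
`(∂ₘ T_{eⱼ} h)ₖ(x)`; the symmetry `∂_b T_a = ∂_a T_b` and the trace identity `Σⱼ ∂ⱼ T_{eⱼ} h = h`
match them ("`curl curl ψ = ∇ div ψ − Δψ`" for the vector potential `ψ = −Γ ∗ h`,
Majda–Bertozzi (2.96)). For `div h = 0` (weakly) `q` is constant and this is Prop. 2.16. [cite: MajdaBertozziCUP2002, §2.4.1 Prop. 2.16 with (2.92)–(2.96) (p. 63–64)] -/
theorem curl_biotSavart_eq_sub_gradient (x : EuclideanSpace ℝ (Fin 3)) :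
    curl (biotSavart h) x = h x - gradient (fun x => ∫ y, fderiv ℝ newtonKernel (x - y) (h y)) x := by
  -- the six(teen) numbers `D j m k = (∂ₘ T_{eⱼ} h)ₖ (x)`
  set D : Fin 3 → Fin 3 → Fin 3 → ℝ := fun j m k =>
    fderiv ℝ (newtonGradPotential (EuclideanSpace.single j (1 : ℝ)) h) x (EuclideanSpace.single m (1 : ℝ)) k with hD
  have hsym : ∀ j m k, D j m k = D m j k := fun j m k => fderiv_newtonGradPotential_single_comm hH hγ hγ1 hs x j m k
  have htr : ∀ k, D 0 0 k + D 1 1 k + D 2 2 k = h x k := fun k => by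
    have h := sum_fderiv_newtonGradPotential_single_apply hH hγ hγ1 hs x k
    simpa only [Fin.sum_univ_three] using h
  have hgrad : ∀ i, gradient (fun x => ∫ y, fderiv ℝ newtonKernel (x - y) (h y)) x i = D 0 i 0 + D 1 i 1 + D 2 i 2 :=
    fun i => by
    rw [gradient_integral_fderiv_newtonKernel_apply hH hγ hγ1 hs x i, Fin.sum_univ_three]
  have hcurl : ∀ m i, fderiv ℝ (biotSavart h) x (EuclideanSpace.single m (1 : ℝ)) i =
      -(![D 1 m 2 - D 2 m 1, D 2 m 0 - D 0 m 2, D 0 m 1 - D 1 m 0] i) := fun m i =>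
    fderiv_biotSavart_apply hH hγ hγ1 hs x _ i
  ext i
  rw [PiLp.sub_apply, hgrad i, curl_eq_curlCLM, curlCLM_apply, PiLp.toLp_apply]
  fin_cases i
  · simp only [Fin.zero_eta, Fin.isValue, Matrix.cons_val_zero, hcurl, Matrix.cons_val_one,
      Matrix.cons_val_two, Matrix.tail_cons, Matrix.head_cons]
    have e1 := hsym 0 1 1
    have e2 := hsym 0 2 2
    linarith [htr 0]
  · simp only [Fin.mk_one, Fin.isValue, Matrix.cons_val_one, Matrix.cons_val_zero, hcurl,
      Matrix.cons_val_two, Matrix.tail_cons, Matrix.head_cons]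
    have e1 := hsym 1 0 0
    have e2 := hsym 1 2 2
    linarith [htr 1]
  · simp only [Fin.reduceFinMk, Fin.isValue, Matrix.cons_val, hcurl, Matrix.cons_val_zero,
      Matrix.cons_val_one]
    have e1 := hsym 2 0 0
    have e2 := hsym 2 1 1
    linarith [htr 2]

end Holder

end Literature.Analysis.FluidPDE
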